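import Literature.MathematicalPhysics.QuantumFieldTheory.LatticeYangMillsBakryEmery
import Summits.Ventures.YMGap.Thresholds.WilsonHessian
import Summits.Ventures.YMGap.Thresholds.HessianSharpAttained

/-!
# Venture YMGap — Theorem C, consequence: Shen–Zhu–Zhu's functional inequalities for
# `|β| < 1/(8d)`, conditionally on the Bakry–Émery transfer step

HONEST FRAMING: venture file (cell `pub-ymgap`, track (a), item A2). KERNEL-CHECKED here:
(i) the hypothesis of Shen–Zhu–Zhu's Bakry–Émery step — the Hessian bound of their Lemma 4.1 with
a constant `Λ₀` (`Literature…WilsonHessianBound d N Λ₀`) — holds with `Λ₀ = 4d`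
(`wilsonHessianBound_four_d`, from `WilsonHessian.abs_second_variation_le_four_d`), hence also with
the printed `8(d-1)` for `d ≥ 2`; (ii) threshold/constant arithmetic. CONDITIONAL (on the NAMED
printed fact `shenZhuZhu_bakryEmery_transfer d N` = SZZ Theorem 4.2/Cor. 4.5 with the Hessian
constant as a parameter, i.e. the Bakry–Émery criterion, NOT proved in the tree):
`sharp_functionalInequalities` — for `d ≥ 2`, `N ≥ 1` and 't Hooft coupling `|β| < 1/(8d)`, every
infinite-volume limit of the torus `SU(N)` Wilson states at tree coupling `Nβ` satisfies the
log-Sobolev and Poincaré inequalities of SZZ Theorem 1.4 (Lipschitz form) with constant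
`K = N/2 - 4dN|β|` in place of `K_S = N/2 - 8(d-1)N|β|` — window `1/(8d)` vs printed `1/(16(d-1))`
(`d = 4`: `1/32` vs `1/48`; `d = 3`: `1/24` vs `1/32`; equal at `d = 2`), and a better constant at
every `β`. Nothing here is a mass-gap / clustering / area-law statement, and nothing is claimed at
physical couplings.

Reference: cell files `p2/HESSIAN-SHARP.md` §3–§4, `p2/SPL-SOS.md`; H. Shen, R. Zhu, X. Zhu,
CMP 400 (2023) 805, Lemma 4.1, Theorem 4.2, Cor. 4.5.
-/

noncomputable section

namespace Summit.Ventures.YMGap.HessianSharp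

open Matrix Complex NormedSpace Finset
open Literature.MathematicalPhysics.QuantumFieldTheory
open scoped Matrix ComplexConjugate BigOperators

variable {d N : ℕ}

/-! ## The kernel theorem discharges the Hessian hypothesis with `Λ₀ = 4d` -/

/-- The Literature functional `wilsonPlaquetteSumAlong U X` is this venture's
`t ↦ wilsonRe (perturb ↑U X t)` (same plaquette order, same exponential curve). -/
theorem wilsonPlaquetteSumAlong_eq {L : ℕ} [NeZero L]
    (U : GaugeConfig d L (Matrix.specialUnitaryGroup (Fin N) ℂ))
    (X : Edge d L → Matrix (Fin N) (Fin N) ℂ) :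
    wilsonPlaquetteSumAlong U X =
      fun t => wilsonRe (perturb (fun e => (U e : Matrix (Fin N) (Fin N) ℂ)) X t) :=
  rfl

/-- The Literature norm `tangentSqNorm X = Σ_e Re tr(X_eX_eᴴ)` is this venture's `tangentNormSq`. -/
theorem tangentSqNorm_eq {L : ℕ} [NeZero L] (X : Edge d L → Matrix (Fin N) (Fin N) ℂ) :
    tangentSqNorm X = tangentNormSq X :=
  rfl

variable (d N) in
/-- **Theorem C in Shen–Zhu–Zhu's format (kernel-checked):** the Hessian bound of SZZ Lemma 4.1
holds with the constant `4d` in place of `8(d-1)`: on every torus, for `Q ∈ SU(N)^{E⁺}` and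
`X ∈ 𝔰𝔲(N)^{E⁺}`, `|d²/dt²|₀ Σ_p Re tr hol_p(e^{tX}Q)| ≤ 4d Σ_e tr(X_eX_e^*)`. -/
theorem wilsonHessianBound_four_d : WilsonHessianBound d N (4 * d) := by
  intro L _ U X hX _
  rw [wilsonPlaquetteSumAlong_eq, tangentSqNorm_eq]
  exact abs_second_variation_le_four_d _ X
    (fun e => (Matrix.mem_specialUnitaryGroup_iff.1 (U e).2).1) hX

/-- In particular SZZ's own Lemma 4.1 (`Λ₀ = 8(d-1)`) follows for `d ≥ 2`, since `4d ≤ 8(d-1)`. -/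
theorem wilsonHessianBound_szz (hd : 2 ≤ d) : WilsonHessianBound d N (8 * ((d : ℝ) - 1)) :=
  (wilsonHessianBound_four_d d N).mono (by
    have : (2 : ℝ) ≤ d := by exact_mod_cast hd
    linarith)

/-- Consistency: the transfer fact alone (with the kernel-checked Hessian bound) gives back the
tree's named fact `shenZhuZhu_functionalInequalities` (SZZ Theorem 1.4, Lipschitz form). -/
theorem shenZhuZhu_functionalInequalities_of_transfer_kernel
    (h : shenZhuZhu_bakryEmery_transfer d N) : shenZhuZhu_functionalInequalities d N := by
  intro hd hN β hβ
  exact shenZhuZhu_functionalInequalities_of_transfer h (wilsonHessianBound_szz hd) hd hN β hβ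

/-! ## The sharp window and constant -/

/-- The sharp Bakry–Émery threshold for `SU(N)` at 't Hooft coupling: `1/(8d)` (HESSIAN-SHARP §4;
Shen–Zhu–Zhu print `1/(16(d-1))`). -/
def sharpThresholdSU (d : ℕ) : ℝ := 1 / (8 * d)

/-- The sharp Bakry–Émery constant `K = N/2 - 4dN|β|` (Ricci `N/2` minus the sharp Hessian
constant `4d · N|β|`; SZZ's `K_S` has `8(d-1)` in place of `4d`). -/
def sharpBakryEmeryConstSU (N d : ℕ) (β : ℝ) : ℝ := (N : ℝ) / 2 - 4 * d * N * |β|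

/-- `K` written as the transfer constant `N/2 - N|β|Λ₀` at `Λ₀ = 4d`. -/
theorem sharpBakryEmeryConstSU_eq (N d : ℕ) (β : ℝ) :
    sharpBakryEmeryConstSU N d β = (N : ℝ) / 2 - N * |β| * (4 * d) := by
  unfold sharpBakryEmeryConstSU
  ring

/-- `K > 0 ↔ |β| < 1/(8d)` (for `d, N ≥ 1`). -/
theorem sharpBakryEmeryConstSU_pos_iff (hd : 1 ≤ d) (hN : 1 ≤ N) (β : ℝ) :
    0 < sharpBakryEmeryConstSU N d β ↔ |β| < sharpThresholdSU d := by
  have hd' : (1 : ℝ) ≤ d := by exact_mod_cast hd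
  have hN' : (1 : ℝ) ≤ N := by exact_mod_cast hN
  have h8 : (0 : ℝ) < 8 * d := by linarith
  unfold sharpBakryEmeryConstSU sharpThresholdSU
  rw [lt_div_iff₀ h8]
  constructor
  · intro h
    nlinarith [abs_nonneg β]
  · intro h
    nlinarith [abs_nonneg β]

/-- **The window, conditional on the Bakry–Émery transfer step.** Assume the named fact
`shenZhuZhu_bakryEmery_transfer d N` (SZZ Theorem 4.2 / Cor. 4.5 with the Hessian constant as a
parameter). Then for `d ≥ 2`, `N ≥ 1` and `|β| < 1/(8d)`, every infinite-volume limit point of the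
torus `SU(N)` Wilson states at coupling `Nβ` satisfies SZZ's log-Sobolev and Poincaré inequalities
(Lipschitz form) with constant `K = N/2 - 4dN|β|`: `Ent_μ(F²) ≤ (2/K) Σ_e L_e²`,
`Var_μ(F) ≤ (1/K) Σ_e L_e²`. The Hessian input is the kernel theorem `wilsonHessianBound_four_d`. -/
theorem sharp_functionalInequalities (h : shenZhuZhu_bakryEmery_transfer d N) (hd : 2 ≤ d)
    (hN : 1 ≤ N) {β : ℝ} (hβ : |β| < sharpThresholdSU d) :
    SZZFunctionalInequalitiesWith d N β (sharpBakryEmeryConstSU N d β) := by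
  have hK : 0 < (N : ℝ) / 2 - N * |β| * (4 * d) := by
    rw [← sharpBakryEmeryConstSU_eq]
    exact (sharpBakryEmeryConstSU_pos_iff (le_trans one_le_two hd) hN β).2 hβ
  have hΛ : (0 : ℝ) ≤ 4 * d := by positivity
  have key := h (4 * d) hΛ (wilsonHessianBound_four_d d N) hd hN β hK
  rwa [← sharpBakryEmeryConstSU_eq] at key

/-! ## Comparison with the printed threshold and constant -/

/-- `1/(16(d-1)) ≤ 1/(8d)` for `d ≥ 2` (equality at `d = 2`). -/
theorem szzThresholdSU_le_sharpThresholdSU (hd : 2 ≤ d) : szzThresholdSU d ≤ sharpThresholdSU d := by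
  have hd' : (2 : ℝ) ≤ d := by exact_mod_cast hd
  unfold szzThresholdSU sharpThresholdSU
  rw [div_le_div_iff₀ (by linarith) (by linarith)]
  linarith

/-- `1/(16(d-1)) < 1/(8d)` for `d ≥ 3`: a strictly larger window. -/
theorem szzThresholdSU_lt_sharpThresholdSU (hd : 3 ≤ d) : szzThresholdSU d < sharpThresholdSU d := by
  have hd' : (3 : ℝ) ≤ d := by exact_mod_cast hd
  unfold szzThresholdSU sharpThresholdSU
  rw [div_lt_div_iff₀ (by linarith) (by linarith)]
  linarith

/-- The sharp constant dominates SZZ's at every coupling: `K_S ≤ K` for `d ≥ 2`. -/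
theorem szzBakryEmeryConstSU_le_sharp (hd : 2 ≤ d) (N : ℕ) (β : ℝ) :
    szzBakryEmeryConstSU N d β ≤ sharpBakryEmeryConstSU N d β := by
  have hd' : (2 : ℝ) ≤ d := by exact_mod_cast hd
  have h := mul_nonneg (mul_nonneg (Nat.cast_nonneg (α := ℝ) N) (abs_nonneg β)) (sub_nonneg.2 hd')
  unfold szzBakryEmeryConstSU sharpBakryEmeryConstSU
  nlinarith [h]

/-- **Optimality of `4d`** (HESSIAN-SHARP Prop. D, kernel-checked in `HessianSharpAttained`):
any constant `Λ₀` for which the Hessian bound of Shen–Zhu–Zhu's Lemma 4.1 holds on all tori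
(`WilsonHessianBound d N Λ₀`) satisfies `4d ≤ Λ₀`, for every `d ≥ 2` and `N ≥ 2` — the frustrated
configuration on `(ℤ/2)^d` attains `4d`. So `1/(8d)` is the exact reach of the pointwise
Bakry–Émery argument in this metric. -/
theorem four_d_le_of_wilsonHessianBound {k m : ℕ} {Λ₀ : ℝ}
    (h : WilsonHessianBound (k + 2) (m + 2) Λ₀) : 4 * (k + 2 : ℕ) ≤ Λ₀ := by
  have hU := h 2 (fun e => ⟨Attained.Qw e, Attained.Qw_mem_specialUnitaryGroup e⟩) Attained.Xw
    Attained.Xw_skew Attained.Xw_trace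
  rw [wilsonPlaquetteSumAlong_eq, tangentSqNorm_eq, iteratedDeriv_two_wilsonRe _ _ Attained.Xw_skew]
    at hU
  change |hessianForm (Attained.Qw (m := m) (k := k)) Attained.Xw|
      ≤ Λ₀ * tangentNormSq (Attained.Xw (m := m) (k := k)) at hU
  obtain ⟨hEq, hpos⟩ := Attained.hessianForm_attained (m := m) (k := k)
  rw [hEq, abs_of_nonneg (by positivity)] at hU
  exact le_of_mul_le_mul_right hU hpos

/-- The same for `2 ≤ d`, `2 ≤ N` stated with inequalities. -/
theorem four_d_le_of_wilsonHessianBound' (hd : 2 ≤ d) (hN : 2 ≤ N) {Λ₀ : ℝ}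
    (h : WilsonHessianBound d N Λ₀) : 4 * (d : ℝ) ≤ Λ₀ := by
  obtain ⟨k, rfl⟩ := Nat.exists_eq_add_of_le' hd
  obtain ⟨m, rfl⟩ := Nat.exists_eq_add_of_le' hN
  exact_mod_cast four_d_le_of_wilsonHessianBound h

/-- Numbers: in `d = 4` the window is `|β| < 1/32` (printed: `1/48`); in `d = 3`, `1/24`
(printed: `1/32`). -/
theorem sharpThresholdSU_values :
    sharpThresholdSU 4 = 1 / 32 ∧ sharpThresholdSU 3 = 1 / 24 ∧
      szzThresholdSU 4 = 1 / 48 ∧ szzThresholdSU 3 = 1 / 32 := by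
  unfold sharpThresholdSU szzThresholdSU
  norm_num

/-- Wilson-coupling form in `d = 4` (`β_W = N² β` for `SU(N)`, tree coupling `Nβ`): the window
`|β| < 1/32` reads `β_W < 1/8` for `SU(2)` and `β_W < 9/32` for `SU(3)` (printed SZZ bar: `1/12`,
resp. `3/16`). Pure arithmetic; no claim at physical couplings. -/
theorem sharpThresholdSU_wilson_values :
    (2 : ℝ) ^ 2 * sharpThresholdSU 4 = 1 / 8 ∧ (3 : ℝ) ^ 2 * sharpThresholdSU 4 = 9 / 32 ∧
      (2 : ℝ) ^ 2 * szzThresholdSU 4 = 1 / 12 ∧ (3 : ℝ) ^ 2 * szzThresholdSU 4 = 3 / 16 := by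
  unfold sharpThresholdSU szzThresholdSU
  norm_num

end Summit.Ventures.YMGap.HessianSharp
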